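import Mathlib.Analysis.SpecialFunctions.Exp
import Mathlib.Analysis.SpecialFunctions.Log.Basic
import Mathlib.Algebra.Order.BigOperators.Group.Finset
import HarnessLib

/-!
# Dimock–Yuan: the two-sided bound on the one-loop coefficient (Lemma 11) — its SHAPE, mode by mode

**Citation header (reproduction of PUBLISHED work; template file of the Balaban lattice Yang–Mills
cell `pub-balaban`, `HOME/BETA/LIT2.md` §1 / TEMPLATE.md §16).**
J. Dimock, C. Yuan, *Structural stability of the RG flow in the Gross–Neveu model*,
Ann. Henri Poincaré **25** (2024), doi 10.1007/s00023-024-01427-0 (= arXiv:2303.07916v3) [DimockYuan2024GNFlow],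
§3.6 "Estimates", **Lemma 11** (TeX label `eleven`, arXiv source ll. 2229–2237) with its proof
(ll. 2241–2278): "There exist positive constants `C_±` such that `(n−1)C₋ ≤ β_k ≤ (n−1)C₊`".

**What is reproduced (everything PROVED, no named facts).**  The printed proof writes the step
coefficient as `β_k = β(w_k + C_k) − β(w_k) = 4(n−1)∫[2w_kC_k + C_k²]` and evaluates both integrals as
weighted momentum sums `Σ′_p (1/p²)(…)`, in which the slice covariance `C_k` has the Fourier multiplier
`c(p) = e^{−p²} − e^{−L²p²}` and the accumulated covariance `w_k` the multiplier
`u_k(p) = e^{−p²/L^{2k}} − e^{−p²}` (ll. 378–384, 1244–1246, 2249–2251, 2273–2275).  The bound then rests on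
exactly three facts, reproduced here MODE BY MODE (i.e. for each momentum `p`, with `t = p² > 0`):
(1) the elementary inequalities "`x e^{−1} ≤ 1 − e^{−x} ≤ x` for `0 ≤ x ≤ 1`" and
"`1 − e^{−1} ≤ 1 − e^{−x} ≤ 1` for `x ≥ 1`" (ll. 2253–2263), giving two-sided bounds for the slice term
`c(p)² = e^{−2t}(1 − e^{−(L²−1)t})²` in the two regions `(L²−1)t ≤ 1`, `(L²−1)t ≥ 1`;
(2) NON-NEGATIVITY of both multipliers, `0 ≤ c(p)` and `0 ≤ u_k(p) ≤ 1` ("Since this is positive …",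
l. 2276), so that the cross term only needs an upper bound;
(3) the resulting abstract two-sided bound for any finite family of modes with non-negative weights:
`a Σ c²m ≤ a Σ (2uc + c²)m ≤ a Σ (c² + 2Uc)m`.
What is NOT reproduced: the `k`-uniform two-sided bounds of the two Riemann sums over the dual tori
`𝕋*_{M+N−k}` (the printed "which suffices", ll. 2260/2268; cell file LIT2.md §1.4) — a statement about
lattice-point sums, not about covariances.

**Why it is in the tree.**  It is the kernel form of lemma shape DY-11 of the β sub-cell's literature
row (LIT2.md §1.5): WHICH properties of the covariances the only printed-and-proved two-sided bound
of a marginal one-loop coefficient in the Balaban–Dimock lineage consumes (same-sign multipliers +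
two elementary inequalities), stated so that a finite-lattice instance can be fed in.  SCOPE: nothing
here refers to or asserts anything about Bałaban's β-functions (CMP 109 (1.22)), whose one-loop
coefficient is a vacuum-polarization (signed) sum to which fact (2) does not apply (LIT2.md §7).

(v2, cell unit `b2b-balaban-template` gen 24 — CITATION HYGIENE ONLY, declarations byte-identical: the bib key is
corrected from the superseded `DimockYuan2024GrossNeveuFlow` (wrong doi/pages, marked «do not use» in references.bib) to
`DimockYuan2024GNFlow` (doi 10.1007/s00023-024-01427-0) in the header and in every `[cite:]` tag — XREAD C-pv02g20-4 INFO I4.)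
-/

noncomputable section

open Finset Real

namespace Literature.MathematicalPhysics.QuantumFieldTheory.DimockYuan2024

/-! ## (1) The two elementary inequalities of the printed proof -/

/-- "`x e^{−1} ≤ 1 − e^{−x} ≤ x` for `0 ≤ x ≤ 1`" — both halves: the upper from `1 − x ≤ e^{−x}`
(Mathlib `Real.add_one_le_exp`; the one-sided lemma is also in the tree as
`Literature.NumberTheory.LFunctions.PrimeReciprocal.one_sub_exp_neg_le`, not imported here to keep this template file's
imports elementary), the lower from `1 − e^{−x} ≥ x e^{−x}` (i.e. `e^{x} ≥ 1 + x`) and `e^{−x} ≥ e^{−1}` on `[0,1]`.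
[cite: DimockYuan2024GNFlow, proof of Lemma 11 (arXiv TeX l. 2255)] -/
theorem exp_neg_twoSided_small {x : ℝ} (hx0 : 0 ≤ x) (hx1 : x ≤ 1) :
    x * Real.exp (-1) ≤ 1 - Real.exp (-x) ∧ 1 - Real.exp (-x) ≤ x := by
  have hpos : 0 < Real.exp (-x) := Real.exp_pos _
  refine ⟨?_, by have h := Real.add_one_le_exp (-x); linarith⟩
  -- x e^{-x} ≤ 1 - e^{-x}, equivalently (1 + x) e^{-x} ≤ 1, from 1 + x ≤ e^{x}
  have h1 : x * Real.exp (-x) ≤ 1 - Real.exp (-x) := by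
    have hx : x + 1 ≤ Real.exp x := Real.add_one_le_exp x
    have hprod : (x + 1) * Real.exp (-x) ≤ Real.exp x * Real.exp (-x) :=
      mul_le_mul_of_nonneg_right hx hpos.le
    rw [← Real.exp_add, add_neg_cancel, Real.exp_zero] at hprod
    linarith
  have h2 : Real.exp (-1) ≤ Real.exp (-x) := Real.exp_le_exp.mpr (by linarith)
  calc x * Real.exp (-1) ≤ x * Real.exp (-x) := mul_le_mul_of_nonneg_left h2 hx0
    _ ≤ 1 - Real.exp (-x) := h1

/-- "`1 − e^{−1} ≤ 1 − e^{−x} ≤ 1` for `x ≥ 1`" — both halves, from monotonicity and positivity of `exp`.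
[cite: DimockYuan2024GNFlow, proof of Lemma 11 (arXiv TeX l. 2263)] -/
theorem exp_neg_twoSided_large {x : ℝ} (hx : 1 ≤ x) :
    1 - Real.exp (-1) ≤ 1 - Real.exp (-x) ∧ 1 - Real.exp (-x) ≤ 1 := by
  have h1 : Real.exp (-x) ≤ Real.exp (-1) := Real.exp_le_exp.mpr (by linarith)
  have h2 := Real.exp_pos (-x)
  constructor <;> linarith

/-- Non-negativity `0 ≤ 1 − e^{−x}` for `x ≥ 0` (used for both multipliers). [folklore] -/
theorem one_sub_exp_neg_nonneg {x : ℝ} (hx : 0 ≤ x) : 0 ≤ 1 - Real.exp (-x) := by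
  have : Real.exp (-x) ≤ 1 := by
    rw [← Real.exp_zero]; exact Real.exp_le_exp.mpr (by linarith)
  linarith

/-! ## (2) The two multipliers of the printed proof, mode by mode (`t = p²`) -/

/-- Fourier multiplier (scalar part) of the slice covariance `C_k`: `c(t) = e^{−t} − e^{−L²t}`, `t = p²`
("`C_k(x−y) = Σ′_p e^{ip(x−y)} (−ip̸/p²)(e^{−p²} − e^{−L²p²})`").
[cite: DimockYuan2024GNFlow, §2.2 (arXiv TeX ll. 378–384)] -/
def sliceMult (L t : ℝ) : ℝ := Real.exp (-t) - Real.exp (-(L ^ 2 * t))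

/-- Fourier multiplier (scalar part) of the accumulated covariance `w_k`: `u_k(t) = e^{−t/L^{2k}} − e^{−t}`
("`w_k(x) = Σ′_p e^{ipx}(−ip̸/p²)(e^{−p²/L^{2k}} − e^{−p²})`").
[cite: DimockYuan2024GNFlow, eq. (wk) (arXiv TeX ll. 1244–1246)] -/
def accumMult (L t : ℝ) (k : ℕ) : ℝ := Real.exp (-(t / L ^ (2 * k))) - Real.exp (-t)

/-- Factorised form `c(t) = e^{−t}(1 − e^{−(L²−1)t})` ("`= Σ′ (e^{−2p²}/p²)(1 − e^{−(L²−1)p²})²`" after squaring).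
[cite: DimockYuan2024GNFlow, proof of Lemma 11 (arXiv TeX ll. 2249–2251)] -/
theorem sliceMult_eq (L t : ℝ) : sliceMult L t = Real.exp (-t) * (1 - Real.exp (-((L ^ 2 - 1) * t))) := by
  unfold sliceMult
  rw [mul_sub, mul_one, ← Real.exp_add]
  congr 2
  ring

/-- `0 ≤ c(t)` for `L ≥ 1`, `t ≥ 0` — the slice multiplier is NON-NEGATIVE (fact (2)).
[cite: DimockYuan2024GNFlow, proof of Lemma 11 (arXiv TeX l. 2276)] -/
theorem sliceMult_nonneg {L t : ℝ} (hL : 1 ≤ L) (ht : 0 ≤ t) : 0 ≤ sliceMult L t := by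
  rw [sliceMult_eq]
  refine mul_nonneg (Real.exp_pos _).le (one_sub_exp_neg_nonneg ?_)
  have : 0 ≤ L ^ 2 - 1 := by nlinarith
  exact mul_nonneg this ht

/-- `0 ≤ u_k(t)` for `L ≥ 1`, `t ≥ 0` — the accumulated multiplier is NON-NEGATIVE (fact (2)).
[cite: DimockYuan2024GNFlow, proof of Lemma 11 (arXiv TeX l. 2276)] -/
theorem accumMult_nonneg {L t : ℝ} (hL : 1 ≤ L) (ht : 0 ≤ t) (k : ℕ) : 0 ≤ accumMult L t k := by
  unfold accumMult
  have hLk : 1 ≤ L ^ (2 * k) := one_le_pow₀ hL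
  have hpos : 0 < L ^ (2 * k) := lt_of_lt_of_le one_pos hLk
  have hdiv : t / L ^ (2 * k) ≤ t := div_le_self ht hLk
  have : Real.exp (-t) ≤ Real.exp (-(t / L ^ (2 * k))) := Real.exp_le_exp.mpr (by linarith)
  linarith

/-- `u_k(t) ≤ 1` for `t ≥ 0` — the uniform upper bound used for the cross term ("bounded by a constant").
[cite: DimockYuan2024GNFlow, proof of Lemma 11 (arXiv TeX ll. 2276–2277)] -/
theorem accumMult_le_one {L t : ℝ} (hL : 1 ≤ L) (ht : 0 ≤ t) (k : ℕ) : accumMult L t k ≤ 1 := by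
  unfold accumMult
  have hLk : 1 ≤ L ^ (2 * k) := one_le_pow₀ hL
  have hpos : 0 < L ^ (2 * k) := lt_of_lt_of_le one_pos hLk
  have h1 : Real.exp (-(t / L ^ (2 * k))) ≤ 1 := by
    rw [← Real.exp_zero]
    exact Real.exp_le_exp.mpr (by have := div_nonneg ht hpos.le; linarith)
  have h2 : 0 < Real.exp (-t) := Real.exp_pos _
  linarith

/-! ## (1)+(2): the two-region two-sided bound for the slice term `c(t)²`, mode by mode -/

/-- Region `(L²−1)t ≤ 1` ("First consider the region (L²−1)p² ≤ 1"): with `x = (L²−1)t ∈ [0,1]`,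
`e^{−2} x² e^{−2t} ≤ c(t)² ≤ x² e^{−2t}` — the mode-wise content of
"`e^{−1}(L²−1)² Σ′ p²e^{−2p²} ≤ ∫C_k² ≤ (L²−1)² Σ′ p²e^{−2p²}`" (there `p²·p^{−2}·p⁴`-bookkeeping: the
weight `1/p²` times `x² = (L²−1)²p⁴` gives `(L²−1)²p²`).
[cite: DimockYuan2024GNFlow, proof of Lemma 11 (arXiv TeX ll. 2252–2260)] -/
theorem sliceMult_sq_bounds_small {L t : ℝ} (hL : 1 ≤ L) (ht : 0 ≤ t) (hreg : (L ^ 2 - 1) * t ≤ 1) :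
    Real.exp (-1) ^ 2 * ((L ^ 2 - 1) * t) ^ 2 * Real.exp (-t) ^ 2 ≤ sliceMult L t ^ 2 ∧
    sliceMult L t ^ 2 ≤ ((L ^ 2 - 1) * t) ^ 2 * Real.exp (-t) ^ 2 := by
  set x := (L ^ 2 - 1) * t with hxdef
  have hx0 : 0 ≤ x := mul_nonneg (by nlinarith) ht
  obtain ⟨hlo, hhi⟩ := exp_neg_twoSided_small hx0 hreg
  have hnn : 0 ≤ 1 - Real.exp (-x) := one_sub_exp_neg_nonneg hx0
  have he : 0 ≤ Real.exp (-t) := (Real.exp_pos _).le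
  have key : sliceMult L t ^ 2 = Real.exp (-t) ^ 2 * (1 - Real.exp (-x)) ^ 2 := by
    rw [sliceMult_eq, hxdef]; ring
  rw [key]
  constructor
  · have h := mul_le_mul hlo hlo (mul_nonneg hx0 (Real.exp_pos _).le) hnn
    have h' : (x * Real.exp (-1)) * (x * Real.exp (-1)) = Real.exp (-1) ^ 2 * x ^ 2 := by ring
    rw [h'] at h
    calc Real.exp (-1) ^ 2 * x ^ 2 * Real.exp (-t) ^ 2 = Real.exp (-t) ^ 2 * (Real.exp (-1) ^ 2 * x ^ 2) := by ring
      _ ≤ Real.exp (-t) ^ 2 * ((1 - Real.exp (-x)) * (1 - Real.exp (-x))) :=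
          mul_le_mul_of_nonneg_left h (pow_nonneg he 2)
      _ = Real.exp (-t) ^ 2 * (1 - Real.exp (-x)) ^ 2 := by ring
  · have h := mul_le_mul hhi hhi hnn hx0
    calc Real.exp (-t) ^ 2 * (1 - Real.exp (-x)) ^ 2 = Real.exp (-t) ^ 2 * ((1 - Real.exp (-x)) * (1 - Real.exp (-x))) := by ring
      _ ≤ Real.exp (-t) ^ 2 * (x * x) := mul_le_mul_of_nonneg_left h (pow_nonneg he 2)
      _ = x ^ 2 * Real.exp (-t) ^ 2 := by ring

/-- Region `(L²−1)t ≥ 1` ("In the region (L²−1)p² ≥ 1"): `(1−e^{−1})² e^{−2t} ≤ c(t)² ≤ e^{−2t}` — the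
mode-wise content of "`(1−e^{−1})² Σ′ e^{−2p²}/p² ≤ ∫C_k² ≤ Σ′ e^{−2p²}/p²`".
[cite: DimockYuan2024GNFlow, proof of Lemma 11 (arXiv TeX ll. 2261–2268)] -/
theorem sliceMult_sq_bounds_large {L t : ℝ} (ht : 0 ≤ t) (hreg : 1 ≤ (L ^ 2 - 1) * t) :
    (1 - Real.exp (-1)) ^ 2 * Real.exp (-t) ^ 2 ≤ sliceMult L t ^ 2 ∧
    sliceMult L t ^ 2 ≤ Real.exp (-t) ^ 2 := by
  set x := (L ^ 2 - 1) * t with hxdef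
  have hx1 : 1 ≤ x := hreg
  obtain ⟨hlo, hhi⟩ := exp_neg_twoSided_large hx1
  have hnn : 0 ≤ 1 - Real.exp (-x) := one_sub_exp_neg_nonneg (by linarith)
  have hc0 : 0 ≤ 1 - Real.exp (-1) := one_sub_exp_neg_nonneg zero_le_one
  have he : 0 ≤ Real.exp (-t) := (Real.exp_pos _).le
  have _ := ht
  have key : sliceMult L t ^ 2 = Real.exp (-t) ^ 2 * (1 - Real.exp (-x)) ^ 2 := by
    rw [sliceMult_eq, hxdef]; ring
  rw [key]
  constructor
  · have h := mul_le_mul hlo hlo hc0 hnn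
    calc (1 - Real.exp (-1)) ^ 2 * Real.exp (-t) ^ 2 = Real.exp (-t) ^ 2 * ((1 - Real.exp (-1)) * (1 - Real.exp (-1))) := by ring
      _ ≤ Real.exp (-t) ^ 2 * ((1 - Real.exp (-x)) * (1 - Real.exp (-x))) := mul_le_mul_of_nonneg_left h (pow_nonneg he 2)
      _ = Real.exp (-t) ^ 2 * (1 - Real.exp (-x)) ^ 2 := by ring
  · have h := mul_le_mul hhi hhi hnn zero_le_one
    calc Real.exp (-t) ^ 2 * (1 - Real.exp (-x)) ^ 2 = Real.exp (-t) ^ 2 * ((1 - Real.exp (-x)) * (1 - Real.exp (-x))) := by ring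
      _ ≤ Real.exp (-t) ^ 2 * (1 * 1) := mul_le_mul_of_nonneg_left h (pow_nonneg he 2)
      _ = Real.exp (-t) ^ 2 := by ring

/-- The cross term, mode by mode: `0 ≤ 2 u_k(t) c(t) ≤ 2 c(t)` for `L ≥ 1`, `t ≥ 0` ("Since this is positive …
it suffice to get an upper bound on this"). [cite: DimockYuan2024GNFlow, proof of Lemma 11 (arXiv TeX ll. 2271–2278)] -/
theorem crossTerm_bounds {L t : ℝ} (hL : 1 ≤ L) (ht : 0 ≤ t) (k : ℕ) :
    0 ≤ 2 * accumMult L t k * sliceMult L t ∧ 2 * accumMult L t k * sliceMult L t ≤ 2 * sliceMult L t := by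
  have hu0 := accumMult_nonneg hL ht k
  have hu1 := accumMult_le_one hL ht k
  have hc0 := sliceMult_nonneg hL ht
  constructor
  · positivity
  · nlinarith

/-! ## (3) The abstract shape: two-sided bound of `β = a Σ (2uc + c²) m` over a finite family of modes -/

/-- **Lemma shape DY-11 (cell file LIT2.md §1.5).**  For a finite family of modes `s` with weights
`m ≥ 0`, a slice multiplier `c ≥ 0`, an accumulated multiplier `0 ≤ u ≤ U` and a vertex factor `a ≥ 0`,
the one-loop step coefficient `β = a Σ_{p∈s} (2 u_p c_p + c_p²) m_p` ("`β_k = 4(n−1)∫[2w_kC_k + C_k²]`")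
satisfies `a Σ c² m ≤ β ≤ a Σ (c² + 2 U c) m`: the lower bound discards the (non-negative) cross term, the
upper bound uses only `u ≤ U`.  In Dimock–Yuan: `a = 4(n−1)`, `m_p = 1/p²` (times the normalisation of
`Σ′`), `c = sliceMult L p²`, `u = accumMult L p² k`, `U = 1`.
[cite: DimockYuan2024GNFlow, proof of Lemma 11 (arXiv TeX ll. 2241–2278)] -/
theorem oneLoopCoeff_twoSided {ι : Type*} (s : Finset ι) {a : ℝ} (ha : 0 ≤ a)
    (m c u U : ι → ℝ) (hm : ∀ p ∈ s, 0 ≤ m p) (hc : ∀ p ∈ s, 0 ≤ c p)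
    (hu : ∀ p ∈ s, 0 ≤ u p) (huU : ∀ p ∈ s, u p ≤ U p) :
    a * ∑ p ∈ s, c p ^ 2 * m p ≤ a * ∑ p ∈ s, (2 * u p * c p + c p ^ 2) * m p ∧
    a * ∑ p ∈ s, (2 * u p * c p + c p ^ 2) * m p ≤ a * ∑ p ∈ s, (c p ^ 2 + 2 * U p * c p) * m p := by
  constructor
  · refine mul_le_mul_of_nonneg_left (Finset.sum_le_sum fun p hp => ?_) ha
    have : 0 ≤ 2 * u p * c p := by
      have := hu p hp; have := hc p hp; positivity
    exact mul_le_mul_of_nonneg_right (by linarith) (hm p hp)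
  · refine mul_le_mul_of_nonneg_left (Finset.sum_le_sum fun p hp => ?_) ha
    have h : 2 * u p * c p ≤ 2 * U p * c p := by
      have := mul_le_mul_of_nonneg_right (huU p hp) (hc p hp)
      linarith
    exact mul_le_mul_of_nonneg_right (by linarith) (hm p hp)

/-- The Dimock–Yuan instance of the shape, for any finite family `s` of momenta with squared lengths
`t_p ≥ 0` and weights `m_p ≥ 0`: `a Σ c(t_p)² m_p ≤ a Σ (2u_k(t_p)c(t_p) + c(t_p)²) m_p ≤ a Σ (c(t_p)² + 2c(t_p)) m_p`,
for `L ≥ 1`, `a ≥ 0`, every `k` — the `k`-INDEPENDENCE of both bounds is the point ("`C_±` … may depend on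
`L`", l. 2225, not on `k`).  The remaining printed step — `k`-uniform bounds of the two sums over the dual
tori — concerns the families `s = 𝕋*_{M+N−k} ∖ {0}` and is not a statement about covariances (LIT2.md §1.4).
[cite: DimockYuan2024GNFlow, Lemma 11 (arXiv TeX ll. 2229–2278)] -/
theorem dimockYuan_oneLoopCoeff_twoSided {ι : Type*} (s : Finset ι) {a L : ℝ} (ha : 0 ≤ a) (hL : 1 ≤ L)
    (t m : ι → ℝ) (ht : ∀ p ∈ s, 0 ≤ t p) (hm : ∀ p ∈ s, 0 ≤ m p) (k : ℕ) :
    a * ∑ p ∈ s, sliceMult L (t p) ^ 2 * m p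
      ≤ a * ∑ p ∈ s, (2 * accumMult L (t p) k * sliceMult L (t p) + sliceMult L (t p) ^ 2) * m p ∧
    a * ∑ p ∈ s, (2 * accumMult L (t p) k * sliceMult L (t p) + sliceMult L (t p) ^ 2) * m p
      ≤ a * ∑ p ∈ s, (sliceMult L (t p) ^ 2 + 2 * 1 * sliceMult L (t p)) * m p :=
  oneLoopCoeff_twoSided s ha m (fun p => sliceMult L (t p)) (fun p => accumMult L (t p) k) (fun _ => 1)
    hm (fun p hp => sliceMult_nonneg hL (ht p hp)) (fun p hp => accumMult_nonneg hL (ht p hp) k)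
    (fun p hp => accumMult_le_one hL (ht p hp) k)


end Literature.MathematicalPhysics.QuantumFieldTheory.DimockYuan2024
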